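import Mathlib.LinearAlgebra.Prod
import Mathlib.Algebra.Module.Submodule.Ker
import Mathlib.Algebra.Module.Submodule.Range
import Mathlib.Tactic.Module
import Mathlib.Tactic.Abel
import HarnessLib

/-!
# `hAL` AT INTEGRAL STRENGTH FROM RIBET'S IDENTITY `U_p + w_p = α^* ∘ β_*` — no Ihara, no saturation — and the bridge from the homology (transpose) convention to convention (A) (cell `b2b-bsdres`, seat additive-p4 gen 40, line V70 — K120)

HONEST FRAMING (verbatim, cell `b2b-bsdres`): the goal of the cell is to DELETE the COMBINATION-SHAPED
residual classes for ALL analytic-rank `≤ 1` curves over `ℚ` — "full BSD formula for every rank `≤ 1`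
curve in class `C`" assembled STRICTLY from published theorems — so that the rank-`≤ 1` remainder
becomes exactly the CONSTRUCTION-SHAPED classes, which are TYPED (missing-input Props), NOT attempted;
this is not "finishing BSD". This file: TOOL theorems (pure module algebra; 0 defs, 0 facts, nothing
booked; X4 stays CONSTRUCTION-shaped; no mark moves).

## Why this file (REFEREE 2, rulings R2-161.2 / R2-162.1)

The kernel files of Proposition V64-B — `X4/UpNilpotentPartOfSemistableLevel` (K114),
`X4/UpNilpotentProjector` (K118a), `X4/UpOldProjector` (K118c), `X4/SaturationSplitsAlongProjector`
(K118d) — all display the hypothesis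

  `hAL : ∀ y, U (U y) − y ∈ LinearMap.range (d₁.coprod dₚ)`

("`U_p² = 1` modulo the `p`-old part" on `Y = H_{pM,𝔪}`, `j′ = d₁.coprod dₚ : K × K → Y` the `p`-old
pair). Over `ℚ` this is the Atkin–Lehner identity `U_p = ∓w_p` on `p`-new forms; REFEREE 2 ruled that at
the instantiation site `hAL` must be discharged at INTEGRAL strength, and suggested that integrally it is
"essentially the saturation of `range j′` in `Y`" (Ihara at `p`, Ribet 1990 Thm. 3.15).

THIS FILE SHOWS THAT NO SATURATION IS NEEDED. Ribet proves (Invent. Math. 100 (1990), proof of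
Prop. 3.7, p. 446, first display) the identity of ENDOMORPHISMS OF `J₀(pM)`

  `w_p + U_p = α^* ∘ β_*`

(`α, β : X₀(pM) → X₀(M)` the two degeneracy maps, `(E, C_M, C_p) ↦ (E, C_M)` resp.
`↦ (E/C_p, (C_M + C_p)/C_p)`; `*` = Pic, `_*` = Albanese functoriality; `U_p` is Ribet's `T_p` at level
`pM`). Being an identity in `End(J₀(pM))`, it holds on every functorial image — integral homology
`H₁(X₀(pM), ℤ)`, Tate modules, character groups, cotangent spaces — and on every direct summand cut
out by Hecke operators prime to `p` (which commute with `w_p`). Consequently `U_p + w_p` maps the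
WHOLE lattice `Y` into `α^*(K) = range d₁ ⊆ range j′`, and since `w_p² = 1` and `U_p` preserves the
`p`-old part, `U_p² ≡ w_p² = 1` modulo `range j′` — INTEGRALLY, on the lattice, with no torsion-freeness,
no Ihara lemma and no saturation hypothesis anywhere (`sq_sub_one_mem_of_add_mem`: even
`w`-stability of the old part is not used; only `U(old) ⊆ old`, `(w² − 1)Y ⊆ old`, `(U + w)Y ⊆ old`).

## Conventions: homology versus q-expansions (REFEREE 2 R2-155.3 (ii), K115)

On `H₁(X₀(pM), ℤ)` with the geometric maps `d₁ = α^*`, `dₚ = ∓β^*` (transfer), `U_p` acts on the old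
pair through the TRANSPOSE convention of `X4/UpNilpotentPartLatticeClause` (K115):
`U (d₁ x) = d₁ (t • x) + dₚ x`, `U (dₚ x) = −(p • d₁ x)` (from `U_p α^* = α^* T_p − β^*`,
`U_p β^* = p·α^*`, the latter being Ribet's identity applied to `β^*`: `(U_p + w_p)β^* = α^* β_* β^* =
(p+1) α^*` and `w_p β^* = α^*`). Convention (A) of K114/K118 (`U (dₚ x) = d₁ x`) is the q-expansion
normalisation `dₚ = B_p = p⁻¹ β^*`, which is NOT a map into the integral homology lattice. The bridge
`convA_of_transpose` repairs this WITHOUT inverting `p`: for transpose data `(d₁, dₚ)` the pair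
`(D₁, Dₚ) := (U ∘ d₁, d₁)` satisfies convention (A) LITERALLY, has the SAME range
(`range_coprod_convA_eq_of_transpose`: `U d₁ (K) + d₁ (K) = d₁ (K) + dₚ (K)`), is injective iff
`d₁.coprod dₚ` is (`injective_coprod_convA_iff_of_transpose`, a unimodular change of coordinates
`(x, z) ↦ (t•x + z, x)` on `K × K`), and its K114-intertwiner `D₁ + (u₀ − t) • Dₚ` IS K115's transpose
intertwiner `u₀ • d₁ + dₚ` (`intertwiner_convA_eq_transpose`). So every theorem of K114/K118a/c/d
applies VERBATIM to integral homology with `j′ := (U ∘ α^*).coprod α^*`, and its `hAL` is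
`hAL_of_atkinLehnerRibet_transpose` below (the statement of `hAL` only depends on `range j′`).

## What is proved

* `sq_sub_one_mem_of_add_mem` — abstract: `O ≤ Y`, `U(O) ⊆ O`, `W (W y) − y ∈ O`, `U y + W y ∈ O`
  for all `y` ⟹ `U (U y) − y ∈ O` for all `y`.
* `hAL_of_atkinLehnerRibet` — `O = range (d₁.coprod dₚ)`, `U`-stable, `W` an involution,
  `U y + W y ∈ range d₁` (Ribet's identity) ⟹ `hAL`.
* `U_coprod_apply_transpose`, `hAL_of_atkinLehnerRibet_transpose` — the same with `U`-stability of
  the old pair DERIVED from the transpose convention; `hAL_of_atkinLehnerRibet_convA` — idem from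
  convention (A).
* `convA_of_transpose`, `coprod_convA_apply`, `coprod_apply_eq_convA`,
  `range_coprod_convA_eq_of_transpose`, `injective_coprod_convA_iff_of_transpose`,
  `intertwiner_convA_eq_transpose` — the convention bridge.

Displayed inputs of the APPLICATION after this file (END-STATE display, memo V66 §4 (a′) / V70): the
modular rules for `U_p` on the `p`-old pair of `H₁(X₀(pM), ℤ)` (transpose convention), Ribet's identity
`U_p + w_p = α^* β_*` (PRINTED), `w_p² = 1`, injectivity of `α^* ⊕ β^*` on `H₁(X₀(M), ℤ_p)_𝔪²`
(characteristic zero: the two degeneracy images are independent), and the Henselian property of the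
coefficient ring resp. one unit (K118a/c). Ihara's lemma at `p` and the saturation of the `p`-old
lattice are NOT among them.

## References (context only; the proofs are elementary)

* K. Ribet, Invent. Math. 100 (1990) 431–476, proof of Prop. 3.7, p. 446: «A calculation gives the
  identity `w_q + T_q = α^* ∘ β_*` of endomorphisms of `J₀(N)`, where `*` and `_*` refer to Pic and
  Albanese functoriality, respectively. In particular, `w_q + T_q` factors through the map
  `β_* : J₀(N) → J₀(M)`.» (`N = qM`, `q ∤ M`); p. 445 for the modular description of `w_q`, `α`, `β`
  (`β = α ∘ w_q`). [cite: Ribet1990, Prop. 3.7 (proof), pp. 445–446]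
* A. O. L. Atkin, J. Lehner, Math. Ann. 185 (1970), Thm. 3 / Lemma 17 (`U_q = −w_q` on `q`-new forms,
  `q ∥` level). [cite: AtkinLehnerMathAnn1970, Thm. 3]
* A. Wiles, Ann. of Math. 141 (1995), §2 (the `p`-old pair and `U_p`). [cite: Wiles1995, §2]
-/

namespace Summit.BirchSwinnertonDyer.Rank1Residual.LevelLowering

section Abstract

variable {R Y : Type*} [CommRing R] [AddCommGroup Y] [Module R Y]

/-- **`U² ≡ 1 (mod O)` from `U ≡ −W (mod O)` and `W² ≡ 1 (mod O)`** — the abstract mechanism. If the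
submodule `O` is `U`-stable, `W (W y) − y ∈ O` and `U y + W y ∈ O` for every `y`, then
`U (U y) − y ∈ O` for every `y`:
`U U y − y = U (U y + W y) − (U (W y) + W (W y)) + (W (W y) − y)`. No torsion-freeness, no saturation,
not even `W`-stability of `O`. [cite: Ribet1990, Prop. 3.7 (proof), pp. 445–446] -/
theorem sq_sub_one_mem_of_add_mem (O : Submodule R Y) (U W : Y →ₗ[R] Y)
    (hUO : ∀ y ∈ O, U y ∈ O) (hW2 : ∀ y, W (W y) - y ∈ O) (hUW : ∀ y, U y + W y ∈ O) (y : Y) :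
    U (U y) - y ∈ O := by
  have h1 : U (U y + W y) ∈ O := hUO _ (hUW y)
  have h2 : U (W y) + W (W y) ∈ O := hUW (W y)
  have h3 : W (W y) - y ∈ O := hW2 y
  have key : U (U y) - y = U (U y + W y) - (U (W y) + W (W y)) + (W (W y) - y) := by
    rw [map_add]; abel
  rw [key]
  exact O.add_mem (O.sub_mem h1 h2) h3

end Abstract

section OldPair

variable {R K Y : Type*} [CommRing R] [AddCommGroup K] [Module R K] [AddCommGroup Y] [Module R Y]

/-- **`hAL` AT INTEGRAL STRENGTH FROM RIBET'S IDENTITY.** For the `p`-old pair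
`j′ = d₁.coprod dₚ : K × K → Y` (any convention making `range j′` `U`-stable), an involution `W` of `Y`
(`= w_p`) and the identity `U y + W y ∈ range d₁` for all `y` (`U_p + w_p = α^* ∘ β_*` in
`End(J₀(pM))`, `d₁ = α^*`), one has `U (U y) − y ∈ range j′` for ALL `y ∈ Y` — the displayed hypothesis
`hAL` of K114/K118a/c/d, on the lattice itself. [cite: Ribet1990, Prop. 3.7 (proof), pp. 445–446] -/
theorem hAL_of_atkinLehnerRibet (d₁ dₚ : K →ₗ[R] Y) (U W : Y →ₗ[R] Y)
    (hUO : ∀ w : K × K, U (d₁.coprod dₚ w) ∈ LinearMap.range (d₁.coprod dₚ))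
    (hW2 : ∀ y, W (W y) = y) (hUW : ∀ y, U y + W y ∈ LinearMap.range d₁) (y : Y) :
    U (U y) - y ∈ LinearMap.range (d₁.coprod dₚ) := by
  refine sq_sub_one_mem_of_add_mem (LinearMap.range (d₁.coprod dₚ)) U W ?_ ?_ ?_ y
  · rintro _ ⟨w, rfl⟩
    exact hUO w
  · intro z
    rw [hW2, sub_self]
    exact Submodule.zero_mem _
  · intro z
    obtain ⟨x, hx⟩ := hUW z
    exact ⟨(x, 0), by simp [hx]⟩

/-- **The transpose (homology) convention acts on the old pair through `[[t, −p],[1, 0]]`:**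
`U (j′ (x, z)) = j′ (t • x − p • z, x)` when `U (d₁ x) = d₁ (t • x) + dₚ x`, `U (dₚ x) = −(p • d₁ x)`
(`d₁ = α^*`, `dₚ = −β^*` on `H₁(X₀(pM), ℤ)`: `U_p α^* = α^* T_p − β^*`, `U_p β^* = p α^*`). In
particular `range j′` is `U`-stable. [cite: Wiles1995, §2] -/
theorem U_coprod_apply_transpose (t p : R) (d₁ dₚ : K →ₗ[R] Y) (U : Y →ₗ[R] Y)
    (hU₁ : ∀ x, U (d₁ x) = d₁ (t • x) + dₚ x) (hUₚ : ∀ x, U (dₚ x) = -(p • d₁ x)) (w : K × K) :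
    U (d₁.coprod dₚ w) = d₁.coprod dₚ (t • w.1 - p • w.2, w.1) := by
  obtain ⟨x, z⟩ := w
  simp only [LinearMap.coprod_apply, map_add, map_sub, map_smul, hU₁, hUₚ]
  abel

/-- **`hAL` on integral homology (transpose convention) from Ribet's identity**: with
`U (d₁ x) = d₁ (t • x) + dₚ x`, `U (dₚ x) = −(p • d₁ x)`, `W` an involution and
`U y + W y ∈ range d₁` for all `y`, one has `U (U y) − y ∈ range (d₁.coprod dₚ)` for all `y`.
[cite: Ribet1990, Prop. 3.7 (proof), pp. 445–446] -/
theorem hAL_of_atkinLehnerRibet_transpose (t p : R) (d₁ dₚ : K →ₗ[R] Y) (U W : Y →ₗ[R] Y)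
    (hU₁ : ∀ x, U (d₁ x) = d₁ (t • x) + dₚ x) (hUₚ : ∀ x, U (dₚ x) = -(p • d₁ x))
    (hW2 : ∀ y, W (W y) = y) (hUW : ∀ y, U y + W y ∈ LinearMap.range d₁) (y : Y) :
    U (U y) - y ∈ LinearMap.range (d₁.coprod dₚ) :=
  hAL_of_atkinLehnerRibet d₁ dₚ U W
    (fun w => ⟨_, (U_coprod_apply_transpose t p d₁ dₚ U hU₁ hUₚ w).symm⟩) hW2 hUW y

/-- **`hAL` under convention (A) from Ribet's identity**: with `U (d₁ x) = d₁ (t • x) − p • dₚ x`,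
`U (dₚ x) = d₁ x` (K114/K118), `W` an involution and `U y + W y ∈ range d₁` for all `y`, one has
`U (U y) − y ∈ range (d₁.coprod dₚ)` for all `y`. (Under convention (A) `U (j′ (x, z)) =
j′ (t • x + z, −(p • x))` — K114's `pOldPair_coprod_apply`, inlined.)
[cite: Ribet1990, Prop. 3.7 (proof), pp. 445–446] -/
theorem hAL_of_atkinLehnerRibet_convA (t p : R) (d₁ dₚ : K →ₗ[R] Y) (U W : Y →ₗ[R] Y)
    (hU₁ : ∀ x, U (d₁ x) = d₁ (t • x) - p • dₚ x) (hUₚ : ∀ x, U (dₚ x) = d₁ x)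
    (hW2 : ∀ y, W (W y) = y) (hUW : ∀ y, U y + W y ∈ LinearMap.range d₁) (y : Y) :
    U (U y) - y ∈ LinearMap.range (d₁.coprod dₚ) := by
  refine hAL_of_atkinLehnerRibet d₁ dₚ U W (fun w => ?_) hW2 hUW y
  refine ⟨(t • w.1 + w.2, -(p • w.1)), ?_⟩
  obtain ⟨x, z⟩ := w
  simp only [LinearMap.coprod_apply, map_add, map_neg, map_smul, hU₁, hUₚ]
  abel

end OldPair

section ConventionBridge

variable {R K Y : Type*} [CommRing R] [AddCommGroup K] [Module R K] [AddCommGroup Y] [Module R Y]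

/-- **THE CONVENTION BRIDGE.** If `(d₁, dₚ)` satisfies the TRANSPOSE convention
`U (d₁ x) = d₁ (t • x) + dₚ x`, `U (dₚ x) = −(p • d₁ x)` (integral homology, `d₁ = α^*`, `dₚ = −β^*`),
then the pair `(D₁, Dₚ) := (U ∘ d₁, d₁)` satisfies CONVENTION (A) of K114/K118 LITERALLY:
`U (D₁ x) = D₁ (t • x) − p • Dₚ x` and `U (Dₚ x) = D₁ x` — without inverting `p`.
[cite: Wiles1995, §2] -/
theorem convA_of_transpose (t p : R) (d₁ dₚ : K →ₗ[R] Y) (U : Y →ₗ[R] Y)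
    (hU₁ : ∀ x, U (d₁ x) = d₁ (t • x) + dₚ x) (hUₚ : ∀ x, U (dₚ x) = -(p • d₁ x)) :
    (∀ x, U ((U ∘ₗ d₁) x) = (U ∘ₗ d₁) (t • x) - p • d₁ x) ∧ (∀ x, U (d₁ x) = (U ∘ₗ d₁) x) := by
  refine ⟨fun x => ?_, fun x => rfl⟩
  simp only [LinearMap.comp_apply, hU₁, map_add, map_smul, hUₚ]
  module

/-- The bridged pair in the old coordinates: `((U ∘ d₁).coprod d₁) (x, z) = (d₁.coprod dₚ) (t • x + z, x)`.
[cite: Wiles1995, §2] -/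
theorem coprod_convA_apply (t : R) (d₁ dₚ : K →ₗ[R] Y) (U : Y →ₗ[R] Y)
    (hU₁ : ∀ x, U (d₁ x) = d₁ (t • x) + dₚ x) (x z : K) :
    ((U ∘ₗ d₁).coprod d₁) (x, z) = (d₁.coprod dₚ) (t • x + z, x) := by
  simp only [LinearMap.coprod_apply, LinearMap.comp_apply, hU₁, map_add, map_smul]
  abel

/-- The old pair in the bridged coordinates: `(d₁.coprod dₚ) (x, z) = ((U ∘ d₁).coprod d₁) (z, x − t • z)`
— the inverse unimodular change of coordinates. [cite: Wiles1995, §2] -/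
theorem coprod_apply_eq_convA (t : R) (d₁ dₚ : K →ₗ[R] Y) (U : Y →ₗ[R] Y)
    (hU₁ : ∀ x, U (d₁ x) = d₁ (t • x) + dₚ x) (x z : K) :
    (d₁.coprod dₚ) (x, z) = ((U ∘ₗ d₁).coprod d₁) (z, x - t • z) := by
  simp only [LinearMap.coprod_apply, LinearMap.comp_apply, hU₁, map_sub, map_smul]
  abel

/-- **Same old lattice**: `range ((U ∘ d₁).coprod d₁) = range (d₁.coprod dₚ)` — the bridged
convention-(A) pair spans EXACTLY the geometric `p`-old part `α^*(K) + β^*(K)`, so the statement of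
`hAL` (and every `range j′`-statement of K114/K118) is the same for both pairs. [cite: Wiles1995, §2] -/
theorem range_coprod_convA_eq_of_transpose (t : R) (d₁ dₚ : K →ₗ[R] Y) (U : Y →ₗ[R] Y)
    (hU₁ : ∀ x, U (d₁ x) = d₁ (t • x) + dₚ x) :
    LinearMap.range ((U ∘ₗ d₁).coprod d₁) = LinearMap.range (d₁.coprod dₚ) := by
  apply le_antisymm
  · rintro _ ⟨⟨x, z⟩, rfl⟩
    exact ⟨(t • x + z, x), (coprod_convA_apply t d₁ dₚ U hU₁ x z).symm⟩
  · rintro _ ⟨⟨x, z⟩, rfl⟩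
    exact ⟨(z, x - t • z), (coprod_apply_eq_convA t d₁ dₚ U hU₁ x z).symm⟩

/-- **Same injectivity**: `(U ∘ d₁).coprod d₁` is injective iff `d₁.coprod dₚ` is (the coordinate
change `(x, z) ↦ (t • x + z, x)` of `K × K` is unimodular with inverse `(a, b) ↦ (b, a − t • b)`), so
K114's `hj` for the bridged pair is the injectivity of `α^* ⊕ β^*`. [cite: Wiles1995, §2] -/
theorem injective_coprod_convA_iff_of_transpose (t : R) (d₁ dₚ : K →ₗ[R] Y) (U : Y →ₗ[R] Y)
    (hU₁ : ∀ x, U (d₁ x) = d₁ (t • x) + dₚ x) :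
    Function.Injective ((U ∘ₗ d₁).coprod d₁) ↔ Function.Injective (d₁.coprod dₚ) := by
  rw [injective_iff_map_eq_zero ((U ∘ₗ d₁).coprod d₁), injective_iff_map_eq_zero (d₁.coprod dₚ)]
  constructor
  · rintro h ⟨x, z⟩ hxz
    have h' : (z, x - t • z) = 0 :=
      h (z, x - t • z) (by rw [← coprod_apply_eq_convA t d₁ dₚ U hU₁ x z, hxz])
    obtain ⟨hz, hx⟩ := Prod.mk_eq_zero.mp h'
    rw [hz, smul_zero, sub_zero] at hx
    rw [hx, hz, Prod.mk_eq_zero]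
    exact ⟨rfl, rfl⟩
  · rintro h ⟨x, z⟩ hxz
    have h' : (t • x + z, x) = 0 :=
      h (t • x + z, x) (by rw [← coprod_convA_apply t d₁ dₚ U hU₁ x z, hxz])
    obtain ⟨h1, hx⟩ := Prod.mk_eq_zero.mp h'
    rw [hx, smul_zero, zero_add] at h1
    rw [hx, h1, Prod.mk_eq_zero]
    exact ⟨rfl, rfl⟩

/-- **Same intertwiner**: K114's convention-(A) intertwiner `D₁ + (u₀ − t) • Dₚ` of the bridged pair
`(D₁, Dₚ) = (U ∘ d₁, d₁)` IS K115's transpose intertwiner `u₀ • d₁ + dₚ` (pointwise), so the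
`u₀`-eigenlattice `range φ₀` of the two files is one and the same sublattice. [cite: Wiles1995, §2] -/
theorem intertwiner_convA_eq_transpose (t u₀ : R) (d₁ dₚ : K →ₗ[R] Y) (U : Y →ₗ[R] Y)
    (hU₁ : ∀ x, U (d₁ x) = d₁ (t • x) + dₚ x) (x : K) :
    ((U ∘ₗ d₁) + (u₀ - t) • d₁) x = (u₀ • d₁ + dₚ) x := by
  simp only [LinearMap.add_apply, LinearMap.smul_apply, LinearMap.comp_apply, hU₁, map_smul]
  module

/-- **`hAL` for the bridged pair** (the form consumed verbatim by K114/K118a/c/d with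
`j′ := (U ∘ d₁).coprod d₁`): from the transpose convention, an involution `W` and Ribet's identity
`U y + W y ∈ range d₁`. [cite: Ribet1990, Prop. 3.7 (proof), pp. 445–446] -/
theorem hAL_convA_of_transpose (t p : R) (d₁ dₚ : K →ₗ[R] Y) (U W : Y →ₗ[R] Y)
    (hU₁ : ∀ x, U (d₁ x) = d₁ (t • x) + dₚ x) (hUₚ : ∀ x, U (dₚ x) = -(p • d₁ x))
    (hW2 : ∀ y, W (W y) = y) (hUW : ∀ y, U y + W y ∈ LinearMap.range d₁) (y : Y) :
    U (U y) - y ∈ LinearMap.range ((U ∘ₗ d₁).coprod d₁) := by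
  rw [range_coprod_convA_eq_of_transpose t d₁ dₚ U hU₁]
  exact hAL_of_atkinLehnerRibet_transpose t p d₁ dₚ U W hU₁ hUₚ hW2 hUW y

end ConventionBridge

/-! ## Appendix (second landing, K120-2): THE COMPANION OPERATOR `T̃ := U + W U W − (p − 1) • W` — an INTEGRAL endomorphism of `Y` restricting to `T_p ⊗ 1` on the `p`-old pair and commuting with `U` and `W`

The kernel files K114/K118 let the coefficient `t = T_p ∈ R` act on `Y = H_{pM,𝔪}` (e.g. in
`ker (U * U − t • U + p • 1)`); on integral homology the level-`M` operator `T_p` has no a-priori action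
on the level-`pM` lattice. The companion operator `T̃ := U + W U W − (p − 1) • W` (Ribet's `T_p + ξ_p −
(p−1) w_p`, `ξ_p = w_p T_p w_p` the Rosati dual) IS such an action: `T̃ ∘ j′ = j′ ∘ (t ⊕ t)`
(`companion_apply_coprod`), `T̃ W = W T̃` (`companion_comm_W`), and `T̃ U = U T̃` on all of `Y`
(`companion_comm_U`) from Ribet's identity `U + W = d₁ ∘ a` (`a = β_*`) together with
`a ∘ W ∘ d₁ = β_* β^* = p + 1`. So `R₀[T̃]` (`R₀` the Hecke operators prime to `p`) is a commutative
ring acting on `K` (via `t`) and on `Y` (via `T̃`) for which `d₁`, `dₚ`, `U`, `W` are linear — the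
coefficient-action input of the application, discharged by construction. PIN for the convention
(REFEREE 2 R2-155.3 (ii)): Ribet 1990, Remark 3.9 (p. 447) prints, for `ρ : J₀(M) × J₀(M) → J₀(Mq)`
by Pic functoriality from `(α, β)`, the unique `ξ` with `ρ ξ = T_q ρ` as `ξ(x, y) = (τ x + q y, −x)`
(`τ = T_q` of level `M`), i.e. `T_q α^* = α^* τ − β^*`, `T_q β^* = q α^*` — the transpose convention
below with `d₁ = α^*`, `dₚ = −β^*`. [cite: Ribet1990, Remark 3.9 (p. 447) and Prop. 3.7 (proof), pp. 445–446] -/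

section Companion

variable {R K Y : Type*} [CommRing R] [AddCommGroup K] [Module R K] [AddCommGroup Y] [Module R Y]

/-- **`T̃ := U + W U W − (p − 1) • W` acts on the `p`-old pair as `T_p ⊗ 1`**: under the transpose
convention `U (d₁ x) = d₁ (t • x) + dₚ x`, `U (dₚ x) = −(p • d₁ x)` (`d₁ = α^*`, `dₚ = −β^*`) and the
Atkin–Lehner swap `W (d₁ x) = −dₚ x`, `W (dₚ x) = −d₁ x` (`w_p α^* = β^*`, `w_p β^* = α^*`):
`T̃ (j′ w) = j′ (t • w)`. [cite: Ribet1990, Prop. 3.7 (proof), pp. 445–446] -/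
theorem companion_apply_coprod (t p : R) (d₁ dₚ : K →ₗ[R] Y) (U W : Y →ₗ[R] Y)
    (hU₁ : ∀ x, U (d₁ x) = d₁ (t • x) + dₚ x) (hUₚ : ∀ x, U (dₚ x) = -(p • d₁ x))
    (hW₁ : ∀ x, W (d₁ x) = -(dₚ x)) (hWₚ : ∀ x, W (dₚ x) = -(d₁ x)) (w : K × K) :
    (U + W * U * W - (p - 1) • W) (d₁.coprod dₚ w) = d₁.coprod dₚ (t • w) := by
  obtain ⟨x, z⟩ := w
  simp only [LinearMap.coprod_apply, Prod.smul_mk, LinearMap.add_apply,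
    LinearMap.sub_apply, LinearMap.smul_apply, Module.End.mul_apply, map_add, map_neg, map_smul,
    hU₁, hUₚ, hW₁, hWₚ, neg_neg, smul_neg]
  module

/-- `T̃` commutes with the involution `W`: `W (T̃ y) = T̃ (W y)` (from `W² = 1` alone). -/
theorem companion_comm_W (p : R) (U W : Y →ₗ[R] Y) (hW2 : ∀ y, W (W y) = y) (y : Y) :
    W ((U + W * U * W - (p - 1) • W) y) = (U + W * U * W - (p - 1) • W) (W y) := by
  simp only [LinearMap.add_apply, LinearMap.sub_apply, LinearMap.smul_apply, Module.End.mul_apply,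
    map_add, map_sub, map_smul, hW2]
  abel

/-- `T̃` in terms of Ribet's `A := U + W = d₁ ∘ a`: `T̃ y = A y + W (A (W y)) − (p + 1) • W y`. -/
theorem companion_apply_eq (p : R) (d₁ : K →ₗ[R] Y) (a : Y →ₗ[R] K) (U W : Y →ₗ[R] Y)
    (hW2 : ∀ y, W (W y) = y) (hUW : ∀ y, U y + W y = d₁ (a y)) (y : Y) :
    (U + W * U * W - (p - 1) • W) y = d₁ (a y) + W (d₁ (a (W y))) - (p + 1) • W y := by
  have hU : ∀ y, U y = d₁ (a y) - W y := fun y => by rw [← hUW y]; abel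
  simp only [LinearMap.add_apply, LinearMap.sub_apply, LinearMap.smul_apply, Module.End.mul_apply,
    hU, map_sub, hW2]
  module

/-- **`T̃` commutes with `U` on ALL of `Y`** — from Ribet's identity `U y + W y = d₁ (a y)` (`a = β_*`),
`W² = 1` and `a (W (d₁ x)) = (p + 1) • x` (`β_* w_p α^* = β_* β^* = deg β = p + 1`): with `A = d₁ ∘ a`
one has `A W A W = (p+1) A W`, `W A W A = (p+1) W A`, whence `[U, T̃] = [A, W A W] − (p+1)[A, W] = 0`.
So `U` is linear over the commutative ring `R₀[T̃]`. [cite: Ribet1990, Prop. 3.7 (proof), pp. 445–446] -/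
theorem companion_comm_U (p : R) (d₁ : K →ₗ[R] Y) (a : Y →ₗ[R] K) (U W : Y →ₗ[R] Y)
    (hW2 : ∀ y, W (W y) = y) (hUW : ∀ y, U y + W y = d₁ (a y))
    (haW₁ : ∀ x, a (W (d₁ x)) = (p + 1) • x) (y : Y) :
    U ((U + W * U * W - (p - 1) • W) y) = (U + W * U * W - (p - 1) • W) (U y) := by
  have hU : ∀ y, U y = d₁ (a y) - W y := fun y => by rw [← hUW y]; abel
  rw [companion_apply_eq p d₁ a U W hW2 hUW, companion_apply_eq p d₁ a U W hW2 hUW]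
  simp only [hU, map_add, map_sub, map_smul, hW2, haW₁]
  module

/-- The degree identity in the old coordinates: under the transpose convention and the swap,
`a := β_*` with `a (d₁ x) = t • x` (`β_* α^* = T_p`) and `a (dₚ x) = −((p + 1) • x)`
(`β_* β^* = p + 1`, `dₚ = −β^*`) satisfies `a (W (d₁ x)) = (p + 1) • x` — the hypothesis `haW₁` of
`companion_comm_U`. [cite: Ribet1990, Prop. 3.7 (proof), pp. 445–446] -/
theorem a_W_d₁_of_swap (p : R) (d₁ dₚ : K →ₗ[R] Y) (a : Y →ₗ[R] K) (W : Y →ₗ[R] Y)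
    (hW₁ : ∀ x, W (d₁ x) = -(dₚ x)) (haₚ : ∀ x, a (dₚ x) = -((p + 1) • x)) (x : K) :
    a (W (d₁ x)) = (p + 1) • x := by
  rw [hW₁, map_neg, haₚ, neg_neg]

end Companion

/-! ## Appendix 2 (third landing, K120-3): THE CONVENTION ITSELF FROM RIBET'S IDENTITY — the action of `U_p` on the `p`-old pair is not an independent input

PRIMITIVE inputs (`a := β_*`): Ribet's identity `U + W = d₁ ∘ a` (p. 446), the swap `W d₁ = −dₚ`, `W dₚ = −d₁`
(`β = α ∘ w_p`, p. 445; `dₚ = −β^*`), `a ∘ d₁ = t` (`β_* α^* = T_p`), `a ∘ dₚ = −(p+1)` (`β_* β^* = deg β`), `W² = 1`;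
from these `transpose_convention_of_ribet` DERIVES K115's transpose convention (Ribet's Remark 3.9 as a
corollary of his Prop. 3.7) and `hAL_of_ribet_data` gives `hAL`. [cite: Ribet1990, Remark 3.9 (p. 447) and Prop. 3.7 (proof), pp. 445–446] -/

section ConventionFromRibet
variable {R K Y : Type*} [CommRing R] [AddCommGroup K] [Module R K] [AddCommGroup Y] [Module R Y]

/-- **The transpose convention DERIVED from Ribet's identity**: if `U y + W y = d₁ (a y)` for all `y`
(`U_p + w_p = α^* β_*`), `W (d₁ x) = −dₚ x`, `W (dₚ x) = −d₁ x` (the Atkin–Lehner swap, `dₚ = −β^*`),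
`a (d₁ x) = t • x` (`β_* α^* = T_p`) and `a (dₚ x) = −((p+1) • x)` (`β_* β^* = p + 1`), then
`U (d₁ x) = d₁ (t • x) + dₚ x` and `U (dₚ x) = −(p • d₁ x)` — Ribet's Remark 3.9.
[cite: Ribet1990, Remark 3.9 (p. 447) and Prop. 3.7 (proof), pp. 445–446] -/
theorem transpose_convention_of_ribet (t p : R) (d₁ dₚ : K →ₗ[R] Y) (a : Y →ₗ[R] K) (U W : Y →ₗ[R] Y)
    (hUW : ∀ y, U y + W y = d₁ (a y)) (hW₁ : ∀ x, W (d₁ x) = -(dₚ x)) (hWₚ : ∀ x, W (dₚ x) = -(d₁ x))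
    (ha₁ : ∀ x, a (d₁ x) = t • x) (haₚ : ∀ x, a (dₚ x) = -((p + 1) • x)) :
    (∀ x, U (d₁ x) = d₁ (t • x) + dₚ x) ∧ (∀ x, U (dₚ x) = -(p • d₁ x)) := by
  have hU : ∀ y, U y = d₁ (a y) - W y := fun y => by rw [← hUW y]; abel
  refine ⟨fun x => ?_, fun x => ?_⟩
  · rw [hU, ha₁, hW₁, sub_neg_eq_add]
  · rw [hU, haₚ, hWₚ, map_neg, map_smul, sub_neg_eq_add]
    module

/-- **`hAL` from the primitive list alone**: Ribet's identity with `a = β_*`, the swap, `β_* α^* = T_p`,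
`β_* β^* = p + 1` and `W² = 1` give `U (U y) − y ∈ range (d₁.coprod dₚ)` for every `y` — via the
derived transpose convention and `hAL_of_atkinLehnerRibet_transpose`.
[cite: Ribet1990, Prop. 3.7 (proof), pp. 445–446] -/
theorem hAL_of_ribet_data (t p : R) (d₁ dₚ : K →ₗ[R] Y) (a : Y →ₗ[R] K) (U W : Y →ₗ[R] Y)
    (hUW : ∀ y, U y + W y = d₁ (a y)) (hW₁ : ∀ x, W (d₁ x) = -(dₚ x)) (hWₚ : ∀ x, W (dₚ x) = -(d₁ x))
    (ha₁ : ∀ x, a (d₁ x) = t • x) (haₚ : ∀ x, a (dₚ x) = -((p + 1) • x)) (hW2 : ∀ y, W (W y) = y)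
    (y : Y) : U (U y) - y ∈ LinearMap.range (d₁.coprod dₚ) := by
  obtain ⟨hU₁, hUₚ⟩ := transpose_convention_of_ribet t p d₁ dₚ a U W hUW hW₁ hWₚ ha₁ haₚ
  exact hAL_of_atkinLehnerRibet_transpose t p d₁ dₚ U W hU₁ hUₚ hW2 (fun z => ⟨a z, (hUW z).symm⟩) y

/-- **Everything at once for the application on `H₁(X₀(pM), ℤ)_𝔪`**: from the primitive list, the
bridged convention-(A) pair `(U ∘ d₁, d₁)` of K114/K118 satisfies convention (A), has `hAL`, and the
companion operator `T̃ = U + W U W − (p − 1) • W` acts as `t ⊗ 1` on the old pair and commutes with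
`U` — the four displayed hypotheses of the Prop. V64-B kernel chain, discharged from Ribet 1990
pp. 445–447 + degrees. [cite: Ribet1990, Remark 3.9 (p. 447) and Prop. 3.7 (proof), pp. 445–446] -/
theorem V64B_inputs_of_ribet_data (t p : R) (d₁ dₚ : K →ₗ[R] Y) (a : Y →ₗ[R] K) (U W : Y →ₗ[R] Y)
    (hUW : ∀ y, U y + W y = d₁ (a y)) (hW₁ : ∀ x, W (d₁ x) = -(dₚ x)) (hWₚ : ∀ x, W (dₚ x) = -(d₁ x))
    (ha₁ : ∀ x, a (d₁ x) = t • x) (haₚ : ∀ x, a (dₚ x) = -((p + 1) • x)) (hW2 : ∀ y, W (W y) = y) :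
    (∀ x, U ((U ∘ₗ d₁) x) = (U ∘ₗ d₁) (t • x) - p • d₁ x) ∧ (∀ x, U (d₁ x) = (U ∘ₗ d₁) x)
    ∧ (∀ y, U (U y) - y ∈ LinearMap.range ((U ∘ₗ d₁).coprod d₁))
    ∧ (∀ w : K × K, (U + W * U * W - (p - 1) • W) (d₁.coprod dₚ w) = d₁.coprod dₚ (t • w))
    ∧ (∀ y, U ((U + W * U * W - (p - 1) • W) y) = (U + W * U * W - (p - 1) • W) (U y)) := by
  obtain ⟨hU₁, hUₚ⟩ := transpose_convention_of_ribet t p d₁ dₚ a U W hUW hW₁ hWₚ ha₁ haₚ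
  have hUW' : ∀ y, U y + W y ∈ LinearMap.range d₁ := fun z => ⟨a z, (hUW z).symm⟩
  obtain ⟨hA₁, hAₚ⟩ := convA_of_transpose t p d₁ dₚ U hU₁ hUₚ
  refine ⟨hA₁, hAₚ, hAL_convA_of_transpose t p d₁ dₚ U W hU₁ hUₚ hW2 hUW',
    companion_apply_coprod t p d₁ dₚ U W hU₁ hUₚ hW₁ hWₚ,
    companion_comm_U p d₁ a U W hW2 hUW (a_W_d₁_of_swap p d₁ dₚ a W hW₁ haₚ)⟩
end ConventionFromRibet

end Summit.BirchSwinnertonDyer.Rank1Residual.LevelLowering
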